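import Summits.ResolutionOfSingularities.ResolutionOfSingularities.Theorems.FrobeniusClosingPatchingRelPerfectConeDepthConeChartsOff
import HarnessLib

/-!
# Crux `PatchingRelPerfect` (stmt-ResolutionOfSingularities-16161), chain W5.2 — rung «r-cone-ℓ», local algebra IV (continued):
# THE QUADRIC CONE ON THE CHART `i = 3`

[OURS · L1 W5.2 · rung tool] Replaces the role of NO printed item; NOT a statement of the manuscript under review; fact-free,
any characteristic, any residue field.  AI-written (AI review is weaker than expert review).

Continuation of `…ConeDepthConeChartsOff` (split only for file size): on the chart `i = 3` of `Bl_𝔪 Spec R` (`R` regular local,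
`𝔪 = (c₀, c₁, c₂, c₃)` minimally) the strict transform of the cone `c₁c₂ + c₃²` reads `f₃ ≡ e₁e₂ + 1` modulo the exceptional
parameter, and at every prime `𝔓` over `𝔪` the list `[φ(c₃), e₀, f₃]` (exceptional divisor, old carrier `c₀`, strict transform of
the cone) is part of a regular system of parameters of `(B₃)_𝔓` after discarding units (`coneChart_three`); `coneFun_ne_three`
records that the three elements are pairwise distinct (needed to feed `sncWithAt_of_adapted`).  Method: kill `e₀` if it lies in
`𝔓`, then the hypersurface `e₁e₂ + 1` in the polynomial ring over the residue field is smooth (Jacobian criterion,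
`isRsopPart_kill_hypersurface`).
-/

-- `Summit.<Summit>.<Sub>.Theorems` with `Sub = Summit` (single-conjunct summit, D-0017)
set_option linter.dupNamespace false

noncomputable section

open IsLocalRing Literature.AlgebraicGeometry.Resolution
open scoped Pointwise

namespace Summit.ResolutionOfSingularities.ResolutionOfSingularities.Theorems

universe u v w

namespace ConeDepth

section Cone

variable {R : Type u} [CommRing R] [IsRegularLocalRing R] (c : Fin 4 → R)
  (hz : Ideal.span (Set.range c) = maximalIdeal R) (hd : (maximalIdeal R).spanFinrank = 4) (i : Fin 4)

local notation3 "Bc" => chartRing c i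
local notation3 "φc" => chartBase c i
local notation3 "ec[" j "]" => chartGen c i j

/-! ### Chart `i = 3`: the strict transform `e₁e₂ + 1` -/

section ChartThree

variable (𝔓 : Ideal (chartRing c 3)) [𝔓.IsPrime] (h𝔓 : 𝔓.comap (chartBase c 3) = maximalIdeal R)
  (L : Type u) [CommRing L] [IsLocalRing L] [Algebra (chartRing c 3) L] [IsLocalization.AtPrime L 𝔓]

omit [IsRegularLocalRing R] in
/-- On the chart `i = 3`: `f₃ ≡ e₁e₂ + 1` (`e₃ = 1`). [folklore] -/
theorem mk_coneFun_three : Ideal.Quotient.mk (Ideal.span {chartBase c 3 (c 3)}) (coneFun c 3) =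
    Ideal.Quotient.mk (Ideal.span {chartBase c 3 (c 3)}) (chartGen c 3 1) *
      Ideal.Quotient.mk (Ideal.span {chartBase c 3 (c 3)}) (chartGen c 3 2) + 1 := by
  have h3 : chartGen c 3 3 = 1 := chartGen_self c 3
  rw [coneFun, map_add, map_mul, map_pow, h3, map_one, one_pow]

include hz hd h𝔓 in
/-- **Chart `i = 3`**: `f₃ = e₁e₂ + 1`; at every prime `𝔓` over `𝔪` the members of `{c₃, e₀, f₃}` lying in `𝔓` are part of one
regular system of parameters of `L` (if `f₃ ∈ 𝔓` then `e₁ ∉ 𝔓` or `e₂ ∉ 𝔓`, and `∂f/∂T₂ = T₁`, `∂f/∂T₁ = T₂`).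
[cite: Matsumura1987, Thm. 14.2] -/
theorem coneChart_three :
    ∃ (m : ℕ) (v : Fin m → L)
      (ι : {g : chartRing c 3 // g ∈ [chartBase c 3 (c 3), chartGen c 3 0, coneFun c 3] ∧ g ∈ 𝔓} → Fin m),
      IsRsopPart v ∧ Function.Injective ι ∧ ∀ g, v (ι g) = (algebraMap (chartRing c 3) L : chartRing c 3 →+* L) g.1 := by
  classical
  by_cases hf : coneFun c 3 ∈ 𝔓
  · have h12 : chartGen c 3 1 ∉ 𝔓 ∨ chartGen c 3 2 ∉ 𝔓 := by
      by_contra h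
      simp only [not_or, not_not] at h
      -- `e₃² = f₃ - e₁e₂ ∈ 𝔓`, but `e₃ = 1` is a unit (read in `L`)
      have heq : chartGen c 3 3 ^ 2 = coneFun c 3 - chartGen c 3 1 * chartGen c 3 2 := by rw [coneFun]; ring
      have h3P : chartGen c 3 3 ∈ 𝔓 :=
        Ideal.IsPrime.mem_of_pow_mem inferInstance 2 (heq ▸ 𝔓.sub_mem hf (𝔓.mul_mem_right _ h.1))
      have h3L := (IsLocalization.AtPrime.to_map_mem_maximal_iff L 𝔓 (chartGen c 3 3)).mpr h3P
      have h3 : chartGen c 3 3 = 1 := chartGen_self c 3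
      rw [h3, map_one] at h3L
      exact (IsLocalRing.maximalIdeal.isMaximal L).ne_top ((Ideal.eq_top_iff_one _).mpr h3L)
    have key : ∀ (l : List {j : Fin 4 // j ≠ (3 : Fin 4)}), l.Nodup → (∀ j ∈ l, j.1 = 0) →
        (∀ j ∈ l, chartGen c 3 j.1 ∈ 𝔓) →
        IsRsopPart (consFamily c 3 L (chartBase c 3) (killFamily 3 (chartGen c 3) l (coneFun c 3))) := by
      intro l hl hl0 hlu
      let σ := {j : {j : Fin 4 // j ≠ (3 : Fin 4)} // j ∉ {j : {j : Fin 4 // j ≠ (3 : Fin 4)} | j ∈ l}}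
      let t1 : σ := ⟨⟨1, by decide⟩, fun h => by have h' := hl0 _ h; simp at h'⟩
      let t2 : σ := ⟨⟨2, by decide⟩, fun h => by have h' := hl0 _ h; simp at h'⟩
      let F : MvPolynomial σ (ResidueField R) := MvPolynomial.X t1 * MvPolynomial.X t2 + 1
      have hfF : coneε c hz hd 3 (MvPolynomial.rename Subtype.val F) = Ideal.Quotient.mk _ (coneFun c 3) := by
        simp only [F, map_add, map_mul, map_one, MvPolynomial.rename_X, coneε_X, mk_coneFun_three, t1, t2]
      have h12' : t1 ≠ t2 := fun h => absurd (congrArg (fun t : σ => t.1.1) h) (show (1 : Fin 4) ≠ 2 by decide)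
      have hF0 : F ≠ 0 := by
        intro h
        have h' := congrArg (MvPolynomial.eval (fun _ : σ => (0 : ResidueField R))) h
        simp only [F, map_add, map_mul, map_one, MvPolynomial.eval_X, mul_zero, zero_add, map_zero] at h'
        exact one_ne_zero h'
      rcases h12 with h1 | h2
      · have hGa : coneε c hz hd 3 (MvPolynomial.rename Subtype.val (MvPolynomial.pderiv t2 F)) =
            Ideal.Quotient.mk _ (chartGen c 3 1) := by
          simp only [F, map_add, Derivation.leibniz, MvPolynomial.pderiv_X_self, MvPolynomial.pderiv_X_of_ne h12',
            MvPolynomial.pderiv_one, mul_zero, add_zero, smul_eq_mul, mul_one, MvPolynomial.rename_X, coneε_X, t1]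
        exact isRsopPart_cone_kill c hz hd 3 𝔓 h𝔓 L l hl hlu hf F hF0 hfF t2 _ hGa h1
      · have hGa : coneε c hz hd 3 (MvPolynomial.rename Subtype.val (MvPolynomial.pderiv t1 F)) =
            Ideal.Quotient.mk _ (chartGen c 3 2) := by
          simp only [F, map_add, Derivation.leibniz, MvPolynomial.pderiv_X_self, MvPolynomial.pderiv_X_of_ne h12'.symm,
            MvPolynomial.pderiv_one, mul_zero, add_zero, smul_eq_mul, mul_one, zero_add, MvPolynomial.rename_X, coneε_X, t2]
        exact isRsopPart_cone_kill c hz hd 3 𝔓 h𝔓 L l hl hlu hf F hF0 hfF t1 _ hGa h2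
    by_cases h0 : chartGen c 3 0 ∈ 𝔓
    · have hrs := key [⟨0, by decide⟩] (List.nodup_singleton _) (by simp) (by simpa using h0)
      exact rsopAdapted_of_consFamily_killFamily c 3 𝔓 L _ (coneFun c 3) hrs _ (fun g hg _ => by
        simp only [List.mem_cons, List.not_mem_nil, or_false] at hg
        rcases hg with rfl | rfl | rfl
        · exact Or.inl rfl
        · exact Or.inr (Or.inl ⟨⟨0, by decide⟩, List.mem_singleton_self _, rfl⟩)
        · exact Or.inr (Or.inr rfl))
    · have hrs := key [] List.nodup_nil (by simp) (by simp)
      exact rsopAdapted_of_consFamily_killFamily c 3 𝔓 L _ (coneFun c 3) hrs _ (fun g hg hgP => by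
        simp only [List.mem_cons, List.not_mem_nil, or_false] at hg
        rcases hg with rfl | rfl | rfl
        · exact Or.inl rfl
        · exact absurd hgP h0
        · exact Or.inr (Or.inr rfl))
  · by_cases h0 : chartGen c 3 0 ∈ 𝔓
    · have hrs := isRsopPart_chartFamily_cone c hz hd 3 𝔓 h𝔓 L (a := 1) (fun _ => ⟨0, by decide⟩)
        (Function.injective_of_subsingleton _) (fun _ => h0)
      exact rsopAdapted_of_chartFamily c 3 𝔓 L _ hrs _ (fun g hg hgP => by
        simp only [List.mem_cons, List.not_mem_nil, or_false] at hg
        rcases hg with rfl | rfl | rfl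
        · exact Or.inl rfl
        · exact Or.inr ⟨0, rfl⟩
        · exact absurd hgP hf)
    · have hrs := isRsopPart_chartFamily_cone c hz hd 3 𝔓 h𝔓 L (a := 0) (fun k => k.elim0)
        (Function.injective_of_subsingleton _) (fun k => k.elim0)
      exact rsopAdapted_of_chartFamily c 3 𝔓 L _ hrs _ (fun g hg hgP => by
        simp only [List.mem_cons, List.not_mem_nil, or_false] at hg
        rcases hg with rfl | rfl | rfl
        · exact Or.inl rfl
        · exact absurd hgP h0
        · exact absurd hgP hf)

include hz hd in
/-- On chart `3`: `coneFun`, `e₀`, `c₃` are pairwise distinct (`T₁T₂ + 1`, `T₀`, `0` modulo `c₃`). [folklore] -/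
theorem coneFun_ne_three : coneFun c 3 ≠ chartBase c 3 (c 3) ∧ coneFun c 3 ≠ chartGen c 3 0 ∧
    chartGen c 3 0 ≠ chartBase c 3 (c 3) := by
  classical
  let F : MvPolynomial {j : Fin 4 // j ≠ (3 : Fin 4)} (ResidueField R) :=
    MvPolynomial.X ⟨1, by decide⟩ * MvPolynomial.X ⟨2, by decide⟩ + 1
  have hfF : coneε c hz hd 3 F = Ideal.Quotient.mk _ (coneFun c 3) := by
    simp only [F, map_add, map_mul, map_one, coneε_X, mk_coneFun_three]
  have hF0 : F ≠ 0 := by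
    intro h
    have h' := congrArg (MvPolynomial.eval (fun _ : {j : Fin 4 // j ≠ (3 : Fin 4)} => (0 : ResidueField R))) h
    simp only [F, map_add, map_mul, map_one, MvPolynomial.eval_X, mul_zero, zero_add, map_zero] at h'
    exact one_ne_zero h'
  have hFX : F ≠ MvPolynomial.X ⟨0, by decide⟩ := by
    intro h
    have h' := congrArg (MvPolynomial.eval (fun _ : {j : Fin 4 // j ≠ (3 : Fin 4)} => (0 : ResidueField R))) h
    simp only [F, map_add, map_mul, map_one, MvPolynomial.eval_X, mul_zero, zero_add] at h'
    exact one_ne_zero h'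
  obtain ⟨h1, h2⟩ := coneFun_ne_of_repr c hz hd 3 F hF0 hfF
  exact ⟨h1, h2 (by decide) hFX, chartGen_zero_ne_chartBase c hz hd 3 (by decide)⟩

end ChartThree

end Cone

end ConeDepth

end Summit.ResolutionOfSingularities.ResolutionOfSingularities.Theorems
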